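import Summits.ValiantsHypothesis.ValiantsHypothesis.Theorems.NewtonUnitEquationsTwoProductsRankOneSchemaLawSliceExc
import HarnessLib

/-!
# Route NewtonUnitEquations — crux `TwoProducts` (stmt-ValiantsHypothesis-5906), line `relation_ladder`, rung R9 (the RANK-ONE
# SCHEMA law: ONE datum `(ρ⁺, ρ⁻)` of ANY shape) by the TRANSPORTATION LIFT — part 5/8 — the planar instance `RelDataG`: the product-plan cell push-forward over the `D`-dilated plane, injectivity from rank one, lifted visible points (T7)

THE RANK-ONE SCHEMA LAW (R9): if ALL additive coincidences of the letter family of `(u, v)` are multiples of ONE datum `(ρ⁺, ρ⁻)` —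
ANY datum `ρ⁺, ρ⁻ : Expo →₀ ℕ`, no side condition — then GLOBALLY `#visible ≤ 2^{c m}(#T + 2)^c` (`c = 1416`).  This is the rank-one SCHEMA
quantified over the datum asked for by the Negative lane (val-neg-1 g4, evidence #48 on stmt-5906, item (a)); it SUBSUMES the rungs R3♯
(`permTypeLaw_proof`), R6, R6b, R6c, R7a, R7b, R7c, R8 (each of their hypotheses exhibits a datum).  Engine = the TRANSPORTATION LIFT of
val-idea-8 g3's memo `Cruxes/TwoProducts/Lines/relation_ladder_R7_engine.md` §1 / `…R8_engine.md` §5 made uniform: for the disjoint balanced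
relation `Σ_{i ∈ P} p_i • α_i = Σ_{j ∈ N} q_j • β_j` the atoms are `Z_{ij}`, `(i, j) ∈ P × N` (upstairs index type `σ ⊕ σ × σ`: free letters on
the left, atoms on the right), `Y_{α_i} ↦ ∏_j Z_{ij}^{q_j}`, `Y_{β_j} ↦ ∏_i Z_{ij}^{p_i}`; the planar push-forward is the PRODUCT PLAN
`E'(Z_{ij})_c = (α_i)_c (β_j)_c T'_{1-c}` over the `D = T'_0 T'_1`-dilated plane (`T_c = Σ_i p_i (α_i)_c`, `T' = max(T, 1)`), the upstairs
weights are the PRODUCT PLAN `θ_{ij} = r_i r_j / R` of the letter weights (pointwise positive, NOT a pull-back; balanced because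
`Σ p_i r_i = Σ q_j r_j`); the fibre over an atom monomial is parametrised by `κ = #α_{a₀}` with a CONSISTENCY guard over all `|P|·|N|` atom
equations; SLICING by the atom exponents (≤ `2^{3m}` slices through the simplex `R8.card_W_le`); the coefficient theorem
`Pfac · C(R + B_κ − 1, B_κ) · κ_κ` and the shift rank `2m(ΣA + 1)² + 1` are shape-independent (the free letters enter only through the binomial);
`ShiftRank.pencilCount` BY NAME.  Reductions: common part of the datum (`DatumExcess.rankOne_reduce`), large / absent coefficients
(`R7a.permType_of_rankOne_largeCoeff/absent`), wide sides (`permType_of_rankOne_wideSide`), and a non-permutation coincidence balances the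
datum and makes both sides non-empty (`sides_of_shift`, over val-neg-1 g4's `OneSidedMembership.weight_*` / `DatumExcess.*`).

AUTHORSHIP / LANE NOTE (val-lit-p3 g16, prover seat, KEEP lineage, helper mode `--supports stmt-ValiantsHypothesis-5906 --as helper`;
CLAIM #1 on the val-lit bus 14:45Z 2026-08-28, ★ 15:03Z; no val-idea-8 seat alive at the time — the typed target is staged for the line
owner as `HOME/lmr/staged/p3g16-R9/sketch_R9.lean`, and the closing theorem is stated by its LITERAL BODY so that a later skeleton can wire
`stub := R9.rankOneSchemaLaw_proof` by name).  Mathematics and Lean text of this module: this seat, generalising its predecessor's R8 port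
(`…RankOneOneSidedLaw*`, val-lit-p3 g15) decl by decl.  Reused BY NAME: `R6b.HSD` (+ closure lemmas), `R7b.dilE`/`piT_dilE`/`piE_dilE`,
`R7a.choose_bridge`, `R7a.permType_of_rankOne_largeCoeff/absent`, `toolBound_mono`, `tab`, `sgn`, `R6b.sum_sgn`, `rW`/`R6b.rW_pos`, `lwt_piT`,
`PlanarCell.eq_of_nsmul_eq`/`wt_sum`, `FormalLogLinearisation.wt_nsmul`, `R8.W`/`R8.card_W_le`, `ShiftRank.pencilCount`,
`BinExpSum.pencilCount_arith`, val-neg-1 g4's `DatumExcess.*`, `RankOneCoverage.eq_of_tsub_eq_zero`, `OneSidedMembership.*`.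
Namespace `…PermutationType.R9`.  Nothing here closes the line's residual (`ResidualLawV20`), the crux `TwoProducts` (5906) or `VP ≠ VNP`;
no summit statement is proved.

Honest scope: coincidence modules of RANK ≥ 2 (val-neg-1 g4's p635223 `RankTwoEscapes`) are NOT covered; after R9 the residual of the line is
«no lattice-small permutation-type contraction (R5), no cheap class cover (R1_r), coincidence rank ≥ 2».  Nothing here moves VP ≠ VNP;
`TwoProducts` (5906) / `PlanarCellBound` stay OPEN. [folklore]

Cut table (scratch `HOME/lmr/staged/p3g16-R9/R9-Scratch.lean`, 2 249 lines, rc 0 / 0 warnings / 0 sorries, axioms standard): part 1 `…Lift` =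
T2 (`GIdx`, `P`/`N`/`rel`/`rest`, `frM` and its coordinates, `Idle`, the table sums `sum_frM_inl/inr`); part 2 `…Fibres` = T3 (`xhat`, `Lrel`,
`Lof`, `Adm`, `sA`, `KR`, `eq_Lof_of_piT`, `piT_Lof`, degrees, `Bk`, `Pfac`, `kap`, `multinomial_Lof_eq`, `coeff_phiT_frM`); part 3 `…Slice` =
T4 slice functions, THE COEFFICIENT THEOREM `coeff_free_logTrunc`, T5 finite shift rank `Fsl_shift`; part 4 `…SliceExc` = the exceptional point,
`mem_support_free_logTrunc_iff`, `Fsl_zero_zero`, `xOf`, `Fsl_congr`; part 5 `…Planar` = T7 `RelDataG`, `D`, `cell`, `enumP`, `piE_enumP_frM`,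
`phi_GT`, `injOn_of_rankOne`, `lifted_of_visible`; part 6 `…Weights` = product-plan weights `θW`, `lwt_θW_frM`, `lwt_splitG`, T8
`sliceMin_of_visible`; part 7 `…Count` = `sliceCount`, `RelDataG.count`, `permType_of_rankOne_wideSide`, `sides_of_shift`, `sum_enum_smul_eq`,
`mapDomain_enum_table`; part 8 `…Law` = arithmetic (`c = 1416`), `rankOneSchemaLaw_proof`.
-/

noncomputable section

-- Sub = Summit single-conjunct layout: the duplicated namespace component is mandated by the tree.
set_option linter.dupNamespace false
set_option linter.unusedSimpArgs false
set_option linter.unusedSectionVars false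
set_option linter.unusedVariables false

namespace Summit.ValiantsHypothesis.ValiantsHypothesis.Theorems.NewtonUnitEquations.TwoProducts.PermutationType
namespace R9
open scoped BigOperators
open MvPolynomial

variable {σ : Type*} [Fintype σ] [DecidableEq σ]

variable (Itr : GIdx σ)
/-! ## Part T7: the planar instance — general relation data `Σ_k pI k • enum k = Σ_k qI k • enum k`, the transportation lift of
the chain, the PRODUCT-PLAN letter push-forward `enumP` over the `D`-dilated plane, injectivity on the lifted support from rank-one
coincidences, lifted visible points, product-plan weights -/

section GenPlanar
open Summit.ValiantsHypothesis.ValiantsHypothesis.Theorems.NewtonUnitEquations.TwoProducts.FormalLogLinearisation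
open Summit.ValiantsHypothesis.ValiantsHypothesis.Theorems.NewtonUnitEquations.TwoProducts.PlanarCell

variable {m : ℕ}
variable (u v : Fin m → MvPolynomial (Fin 2) ℂ)

/-- **Planar general relation data**: coefficient vectors `pI`, `qI` on the tail letters with disjoint supports, a distinguished
letter on each side, and the relation `Σ_k pI k • enum k = Σ_k qI k • enum k`. [folklore] -/
structure RelDataG where
  /-- the `P`-side coefficients on the tail letters -/
  pI : Fin (sE u v) → ℕ
  /-- the `N`-side coefficients on the tail letters -/
  qI : Fin (sE u v) → ℕ
  /-- a distinguished `P` letter -/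
  a₀ : Fin (sE u v)
  /-- a distinguished `N` letter -/
  b₀ : Fin (sE u v)
  hpa : pI a₀ ≠ 0
  hqb : qI b₀ ≠ 0
  hdisj : ∀ k, pI k = 0 ∨ qI k = 0
  hrel : ∑ k, pI k • enum u v k = ∑ k, qI k • enum u v k

variable {u v}
variable (Dtr : RelDataG u v)

/-- The index data of the relation. [folklore] -/
def RelDataG.idx : GIdx (Fin (sE u v)) := ⟨Dtr.pI, Dtr.qI, Dtr.a₀, Dtr.b₀, Dtr.hpa, Dtr.hqb, Dtr.hdisj⟩

/-- Field projections of the index data. [folklore] -/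
theorem RelDataG.idx_pf : Dtr.idx.pf = Dtr.pI := rfl
/-- Field projections of the index data. [folklore] -/
theorem RelDataG.idx_qf : Dtr.idx.qf = Dtr.qI := rfl
/-- Field projections of the index data. [folklore] -/
theorem RelDataG.idx_a₀ : Dtr.idx.a₀ = Dtr.a₀ := rfl
/-- Field projections of the index data. [folklore] -/
theorem RelDataG.idx_b₀ : Dtr.idx.b₀ = Dtr.b₀ := rfl

/-- The common planar mass of the two sides in coordinate `c`: `T_c = Σ_k pI k · (enum k)_c`. [folklore] -/
def RelDataG.Tsum (c : Fin 2) : ℕ := ∑ k, Dtr.pI k * enum u v k c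

/-- The planar mass computed on the `N` side. [folklore] -/
theorem RelDataG.Tsum_eq (c : Fin 2) : Dtr.Tsum c = ∑ k, Dtr.qI k * enum u v k c := by
  have h := DFunLike.congr_fun Dtr.hrel c
  simp only [Finsupp.coe_finsetSum, Finset.sum_apply, Finsupp.coe_smul, Pi.smul_apply, smul_eq_mul] at h
  exact h

/-- The positive surrogate `T'_c = max(T_c, 1)`. [folklore] -/
def RelDataG.Tp (c : Fin 2) : ℕ := if Dtr.Tsum c = 0 then 1 else Dtr.Tsum c

/-- `T'_c ≥ 1`. [folklore] -/
theorem RelDataG.Tp_pos (c : Fin 2) : 1 ≤ Dtr.Tp c := by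
  unfold RelDataG.Tp; split_ifs with h
  · exact le_rfl
  · exact Nat.one_le_iff_ne_zero.mpr h

/-- The dilation factor `D = T'_0 · T'_1`. [folklore] -/
def RelDataG.D : ℕ := Dtr.Tp 0 * Dtr.Tp 1

/-- `D ≥ 1`. [folklore] -/
theorem RelDataG.D_pos : 1 ≤ Dtr.D := Nat.one_le_iff_ne_zero.mpr (Nat.mul_ne_zero (by have := Dtr.Tp_pos 0; omega)
  (by have := Dtr.Tp_pos 1; omega))

/-- The complementary factor `M_c = T'_{1-c}`. [folklore] -/
def RelDataG.M (c : Fin 2) : ℕ := if c = 0 then Dtr.Tp 1 else Dtr.Tp 0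

/-- `T_c · M_c = D` when `T_c ≠ 0`. [folklore] -/
theorem RelDataG.Tsum_mul_M (c : Fin 2) (h : Dtr.Tsum c ≠ 0) : Dtr.Tsum c * Dtr.M c = Dtr.D := by
  have hT : Dtr.Tp c = Dtr.Tsum c := by unfold RelDataG.Tp; rw [if_neg h]
  rw [← hT]
  unfold RelDataG.M RelDataG.D
  by_cases hc : c = 0
  · subst hc; rw [if_pos rfl]
  · have hc1 : c = 1 := Fin.eq_one_of_ne_zero c hc
    subst hc1; rw [if_neg (by decide), Nat.mul_comm]

/-- A `P` letter has zero `c`-coordinate when `T_c = 0`. [folklore] -/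
theorem RelDataG.enum_eq_zero_of_Tsum_P (c : Fin 2) (h : Dtr.Tsum c = 0) {k : Fin (sE u v)} (hk : Dtr.pI k ≠ 0) :
    enum u v k c = 0 := by
  unfold RelDataG.Tsum at h
  have := (Finset.sum_eq_zero_iff.mp h) k (Finset.mem_univ _)
  rcases Nat.mul_eq_zero.mp this with h' | h'
  · exact absurd h' hk
  · exact h'

/-- An `N` letter has zero `c`-coordinate when `T_c = 0`. [folklore] -/
theorem RelDataG.enum_eq_zero_of_Tsum_N (c : Fin 2) (h : Dtr.Tsum c = 0) {k : Fin (sE u v)} (hk : Dtr.qI k ≠ 0) :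
    enum u v k c = 0 := by
  rw [Dtr.Tsum_eq] at h
  have := (Finset.sum_eq_zero_iff.mp h) k (Finset.mem_univ _)
  rcases Nat.mul_eq_zero.mp this with h' | h'
  · exact absurd h' hk
  · exact h'

/-- The PRODUCT-PLAN cell value of the atom `Z_{ij}`: `(enum i)_c (enum j)_c M_c` in coordinate `c`. [folklore] -/
def RelDataG.cell (i j : Fin (sE u v)) : Expo := ofFun fun c => enum u v i c * enum u v j c * Dtr.M c

/-- Coordinates of a cell. [folklore] -/
theorem RelDataG.cell_apply (i j : Fin (sE u v)) (c : Fin 2) : Dtr.cell i j c = enum u v i c * enum u v j c * Dtr.M c := by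
  unfold RelDataG.cell; rw [ofFun_apply]

/-- The `D`-DILATED planar push-forward of the upstairs variables: free letters to `D · enum`, atoms to their cells. [folklore] -/
def RelDataG.enumP : Fin (sE u v) ⊕ Fin (sE u v) × Fin (sE u v) → Expo
  | Sum.inl k => Dtr.D • enum u v k
  | Sum.inr ij => Dtr.cell ij.1 ij.2

/-- The push-forward at a free coordinate. [folklore] -/
theorem RelDataG.enumP_inl (k : Fin (sE u v)) : Dtr.enumP (Sum.inl k) = Dtr.D • enum u v k := rfl

/-- The push-forward at an atom coordinate. [folklore] -/
theorem RelDataG.enumP_inr (i j : Fin (sE u v)) : Dtr.enumP (Sum.inr (i, j)) = Dtr.cell i j := rfl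

/-- Coordinates of a planar push-forward. [folklore] -/
theorem piE_apply_coord {τ : Type*} [Fintype τ] (E : τ → Expo) (κ : τ →₀ ℕ) (c : Fin 2) :
    piE E κ c = ∑ t, κ t * E t c := by
  rw [piE_eq_piT, piT_apply]

/-- A `P`-weighted sum over `P` is the sum over all letters. [folklore] -/
theorem RelDataG.sum_P_pI {R : Type*} [CommSemiring R] (f : Fin (sE u v) → R) :
    ∑ i ∈ P Dtr.idx, (Dtr.pI i : R) * f i = ∑ i, (Dtr.pI i : R) * f i := by
  refine Finset.sum_subset (Finset.subset_univ _) fun i _ hi => ?_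
  rw [mem_P, Dtr.idx_pf] at hi; push Not at hi; rw [hi]; simp

/-- An `N`-weighted sum over `N` is the sum over all letters. [folklore] -/
theorem RelDataG.sum_N_qI {R : Type*} [CommSemiring R] (f : Fin (sE u v) → R) :
    ∑ j ∈ N Dtr.idx, (Dtr.qI j : R) * f j = ∑ j, (Dtr.qI j : R) * f j := by
  refine Finset.sum_subset (Finset.subset_univ _) fun j _ hj => ?_
  rw [mem_N, Dtr.idx_qf] at hj; push Not at hj; rw [hj]; simp

/-- **The product plan balances**: the dilated push-forward of a substituted letter is `D` times the letter,
`π_{enumP} (frM k) = D • enum k`. [folklore] -/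
theorem RelDataG.piE_enumP_frM (k : Fin (sE u v)) : piE Dtr.enumP (frM Dtr.idx k) = Dtr.D • enum u v k := by
  classical
  refine Finsupp.ext fun c => ?_
  rw [piE_apply_coord, Fintype.sum_sum_type, Fintype.sum_prod_type]
  simp only [Dtr.enumP_inl, Dtr.enumP_inr, Finsupp.smul_apply, smul_eq_mul, Dtr.cell_apply]
  have h1 := sum_frM_inl Dtr.idx (R := ℕ) (fun k' => Dtr.D * enum u v k' c) k
  have h2 := sum_frM_inr Dtr.idx (R := ℕ) (fun i j => enum u v i c * enum u v j c * Dtr.M c) k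
  simp only [Nat.cast_id] at h1 h2
  rw [h1, h2, Dtr.idx_pf, Dtr.idx_qf]
  have eP : ∑ i ∈ P Dtr.idx, Dtr.pI i * (enum u v i c * enum u v k c * Dtr.M c) = Dtr.Tsum c * (enum u v k c * Dtr.M c) := by
    have := Dtr.sum_P_pI (R := ℕ) (fun i => enum u v i c * enum u v k c * Dtr.M c)
    simp only [Nat.cast_id] at this
    rw [this]; unfold RelDataG.Tsum; rw [Finset.sum_mul]
    exact Finset.sum_congr rfl fun i _ => by ring
  have eN : ∑ j ∈ N Dtr.idx, Dtr.qI j * (enum u v k c * enum u v j c * Dtr.M c) = Dtr.Tsum c * (enum u v k c * Dtr.M c) := by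
    have := Dtr.sum_N_qI (R := ℕ) (fun j => enum u v k c * enum u v j c * Dtr.M c)
    simp only [Nat.cast_id] at this
    rw [this, Dtr.Tsum_eq c, Finset.sum_mul]
    exact Finset.sum_congr rfl fun j _ => by ring
  by_cases hk : Dtr.pI k = 0 ∧ Dtr.qI k = 0
  · rw [if_pos hk, if_neg (by simpa using hk.1), if_neg (by simpa using hk.2), add_zero, add_zero]
  · rw [if_neg hk, zero_add]
    rcases Dtr.hdisj k with hp | hq
    · have hq : Dtr.qI k ≠ 0 := fun h => hk ⟨hp, h⟩
      rw [if_neg (by simpa using hp), if_pos hq, zero_add, eP]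
      by_cases hT : Dtr.Tsum c = 0
      · rw [hT, zero_mul, Dtr.enum_eq_zero_of_Tsum_N c hT hq, mul_zero]
      · rw [show Dtr.Tsum c * (enum u v k c * Dtr.M c) = (Dtr.Tsum c * Dtr.M c) * enum u v k c by ring, Dtr.Tsum_mul_M c hT]
    · have hp : Dtr.pI k ≠ 0 := fun h => hk ⟨h, hq⟩
      rw [if_pos hp, if_neg (by simpa using hq), add_zero, eN]
      by_cases hT : Dtr.Tsum c = 0
      · rw [hT, zero_mul, Dtr.enum_eq_zero_of_Tsum_P c hT hp, mul_zero]
      · rw [show Dtr.Tsum c * (enum u v k c * Dtr.M c) = (Dtr.Tsum c * Dtr.M c) * enum u v k c by ring, Dtr.Tsum_mul_M c hT]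

/-- Substitution composed with the dilated push-forward equals the `D`-dilation of the letter push-forward. [folklore] -/
theorem RelDataG.comp_eq : (fun k => piT Dtr.enumP (frM Dtr.idx k)) = fun k => piT (R7b.dilE Dtr.D) (enum u v k) := by
  funext k
  rw [← piE_eq_piT, Dtr.piE_enumP_frM, R7b.piT_dilE]

/-- On exponents: dilated push-forward ∘ substitution = `D` · letter push-forward. [folklore] -/
theorem RelDataG.piE_enumP_piT (L : Fin (sE u v) →₀ ℕ) : piE Dtr.enumP (piT (frM Dtr.idx) L) = Dtr.D • piE (enum u v) L := by
  rw [piE_eq_piT, piE_eq_piT, piT_piT, Dtr.comp_eq, ← piT_piT, R7b.piT_dilE]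

/-- On polynomials: dilated push-forward ∘ substitution = dilation ∘ letter push-forward. [folklore] -/
theorem RelDataG.phi_enumP_phiT (H : MvPolynomial (Fin (sE u v)) ℂ) :
    phi Dtr.enumP (phiT (frM Dtr.idx) H) = phi (R7b.dilE Dtr.D) (phi (enum u v) H) := by
  rw [phi_eq_phiT, phi_eq_phiT, phi_eq_phiT, phiT_phiT, Dtr.comp_eq, ← phiT_phiT]

/-- The transportation lift of the chain difference. [folklore] -/
def RelDataG.GT : MvPolynomial (Fin (sE u v) ⊕ Fin (sE u v) × Fin (sE u v)) ℂ :=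
  phiT (frM Dtr.idx) (liftG (cU u v) (cV u v))

/-- Its dilated push-forward is the `D`-dilation of the planar difference of products. [folklore] -/
theorem RelDataG.phi_GT : phi Dtr.enumP Dtr.GT = phi (R7b.dilE Dtr.D) (tailDiff u v) := by
  unfold RelDataG.GT
  rw [Dtr.phi_enumP_phiT, phi_liftG]

/-- Exponents of the lift are substituted chain exponents. [folklore] -/
theorem RelDataG.exists_of_mem_support_GT (x : Fin (sE u v) ⊕ Fin (sE u v) × Fin (sE u v) →₀ ℕ)
    (hx : x ∈ Dtr.GT.support) : ∃ L ∈ (liftG (cU u v) (cV u v)).support, piT (frM Dtr.idx) L = x :=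
  exists_of_mem_support_phiT (frM Dtr.idx) _ x hx

/-- Exponents of the lift are idle-free. [folklore] -/
theorem RelDataG.idle_of_mem_support_GT (x : Fin (sE u v) ⊕ Fin (sE u v) × Fin (sE u v) →₀ ℕ)
    (hx : x ∈ Dtr.GT.support) : Idle Dtr.idx x := by
  obtain ⟨L, -, rfl⟩ := Dtr.exists_of_mem_support_GT x hx
  exact idle_piT Dtr.idx L

/-- The `P` side of the relation as a letter multiset. [folklore] -/
def RelDataG.rhoP : Expo →₀ ℕ := Finsupp.mapDomain (enum u v) (ofFun Dtr.pI)

/-- The `N` side of the relation as a letter multiset. [folklore] -/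
def RelDataG.rhoM : Expo →₀ ℕ := Finsupp.mapDomain (enum u v) (ofFun Dtr.qI)

/-- The two sides of the relation have the same lift: `π_frM(pI) = π_frM(qI)` (the atom matrix `pI i · qI j`). [folklore] -/
theorem RelDataG.piT_frM_sides : piT (frM Dtr.idx) (ofFun Dtr.pI) = piT (frM Dtr.idx) (ofFun Dtr.qI) := by
  ext t
  rcases t with k | ⟨i, j⟩
  · rw [piT_frM_inl, piT_frM_inl, ofFun_apply, ofFun_apply, Dtr.idx_pf, Dtr.idx_qf]
    split_ifs with h
    · rw [h.1, h.2]
    · rfl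
  · rw [piT_frM_inr, piT_frM_inr, ofFun_apply, ofFun_apply, ofFun_apply, ofFun_apply, Dtr.idx_pf, Dtr.idx_qf]
    split_ifs with h
    · have hqi : Dtr.qI i = 0 := by rcases Dtr.hdisj i with h' | h'; exact absurd h' h.1; exact h'
      have hpj : Dtr.pI j = 0 := by rcases Dtr.hdisj j with h' | h'; exact h'; exact absurd h' h.2
      rw [hqi, hpj]; ring
    · rfl

/-- **Injectivity from rank-one coincidences**, for the dilated push-forward. [folklore] -/
theorem RelDataG.injOn_of_rankOne (hu : ∀ j, coeff 0 (u j) = 0) (hv : ∀ j, coeff 0 (v j) = 0)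
    (hR : RankOneCoincidences (fun j => (u j).support ∪ (v j).support) Dtr.rhoP Dtr.rhoM) :
    Set.InjOn (piE Dtr.enumP) ↑Dtr.GT.support := by
  classical
  set A : Fin m → Finset Expo := fun j => (u j).support ∪ (v j).support with hA
  have hcU : ∀ j i, cU u v j i ≠ 0 → enum u v i ∈ A j := fun j i h =>
    Finset.mem_union_left _ (mem_support_iff.mpr h)
  have hcV : ∀ j i, cV u v j i ≠ 0 → enum u v i ∈ A j := fun j i h =>
    Finset.mem_union_right _ (mem_support_iff.mpr h)
  have key : ∀ κ ∈ (liftG (cU u v) (cV u v)).support,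
      ∃ a ∈ tuples A, ∑ j, a j = piE (enum u v) κ ∧ msetT a = Finsupp.mapDomain (enum u v) κ := by
    intro κ hκ
    unfold liftG at hκ
    rcases Finset.mem_union.1 (support_sub _ _ _ hκ) with h | h
    · exact tuple_of_mem_support_prod u v hu hv A (cU u v) hcU κ h
    · exact tuple_of_mem_support_prod u v hu hv A (cV u v) hcV κ h
  set ρp : Fin (sE u v) →₀ ℕ := ofFun Dtr.pI with hρp
  set ρm : Fin (sE u v) →₀ ℕ := ofFun Dtr.qI with hρm
  have hmp : Finsupp.mapDomain (enum u v) ρp = Dtr.rhoP := rfl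
  have hmm : Finsupp.mapDomain (enum u v) ρm = Dtr.rhoM := rfl
  have hπρ : piT (frM Dtr.idx) ρp = piT (frM Dtr.idx) ρm := Dtr.piT_frM_sides
  have hmapk : ∀ (k : ℕ) (L ρ : Fin (sE u v) →₀ ℕ),
      Finsupp.mapDomain (enum u v) (L + k • ρ) = Finsupp.mapDomain (enum u v) L + k • Finsupp.mapDomain (enum u v) ρ := by
    intro k L ρ
    rw [Finsupp.mapDomain_add]
    congr 1
    exact map_nsmul (Finsupp.mapDomain.addMonoidHom (enum u v)) k ρ
  have cancel : ∀ (k : ℕ) (L L' : Fin (sE u v) →₀ ℕ), L + k • ρp = L' + k • ρm →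
      piT (frM Dtr.idx) L = piT (frM Dtr.idx) L' := by
    intro k L L' h
    have := congrArg (piT (frM Dtr.idx)) h
    rw [piT_add, piT_add, piT_nsmul, piT_nsmul, hπρ] at this
    exact add_right_cancel this
  intro x hx x' hx' hπ
  obtain ⟨L, hL, rfl⟩ := Dtr.exists_of_mem_support_GT x hx
  obtain ⟨L', hL', rfl⟩ := Dtr.exists_of_mem_support_GT x' hx'
  rw [Dtr.piE_enumP_piT, Dtr.piE_enumP_piT] at hπ
  replace hπ := PlanarCell.eq_of_nsmul_eq Dtr.D_pos hπ
  obtain ⟨a, ha, haS, haM⟩ := key L hL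
  obtain ⟨b, hb, hbS, hbM⟩ := key L' hL'
  obtain ⟨k, hk⟩ := hR a ha b hb (by rw [haS, hbS]; exact hπ)
  rw [haM, hbM, ← hmp, ← hmm, ← hmapk, ← hmapk, ← hmapk, ← hmapk] at hk
  rcases hk with hk | hk
  · exact cancel k L L' (Finsupp.mapDomain_injective (enum_injective u v) hk)
  · exact (cancel k L' L (Finsupp.mapDomain_injective (enum_injective u v) hk)).symm

/-- Visible points lift (over `D · l`) to strict `ξ`-maxima of the lifted support (under injectivity). [folklore] -/
theorem RelDataG.lifted_of_visible (hinj : Set.InjOn (piE Dtr.enumP) ↑Dtr.GT.support) (ξ : Fin 2 → ℝ) (l : Expo)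
    (htop : IsStrictTop ξ ↑(tailDiff u v).support l) :
    ∃ x₀ : Fin (sE u v) ⊕ Fin (sE u v) × Fin (sE u v) →₀ ℕ, x₀ ∈ Dtr.GT.support ∧ piE Dtr.enumP x₀ = Dtr.D • l ∧
      ∀ x ∈ Dtr.GT.support, x ≠ x₀ → wt ξ (piE Dtr.enumP x) < wt ξ (Dtr.D • l) := by
  have hsupp : phi Dtr.enumP Dtr.GT = phi (R7b.dilE Dtr.D) (tailDiff u v) := Dtr.phi_GT
  have hinjD : Set.InjOn (piE (R7b.dilE Dtr.D)) ↑(tailDiff u v).support := fun e _ e' _ h => by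
    rw [R7b.piE_dilE, R7b.piE_dilE] at h; exact PlanarCell.eq_of_nsmul_eq Dtr.D_pos h
  obtain ⟨hl, hlt⟩ := htop
  have hl' : Dtr.D • l ∈ (phi Dtr.enumP Dtr.GT).support := by
    rw [hsupp, mem_support_iff, ← R7b.piE_dilE Dtr.D l, coeff_phi_of_injOn (R7b.dilE Dtr.D) _ hinjD l hl]
    exact mem_support_iff.mp hl
  obtain ⟨x₀, hx₀, hπ⟩ := exists_of_mem_support_phi Dtr.enumP _ _ hl'
  refine ⟨x₀, hx₀, hπ, fun x hx hne => ?_⟩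
  have hmem : piE Dtr.enumP x ∈ (phi (R7b.dilE Dtr.D) (tailDiff u v)).support := by
    rw [← hsupp, mem_support_iff, coeff_phi_of_injOn Dtr.enumP _ hinj x hx]
    exact mem_support_iff.mp hx
  obtain ⟨e, he, hπe⟩ := exists_of_mem_support_phi (R7b.dilE Dtr.D) _ _ hmem
  rw [R7b.piE_dilE] at hπe
  have hne' : e ≠ l := by
    intro h; apply hne; apply hinj hx hx₀; rw [← hπe, h, hπ]
  have h1 := hlt e he hne'
  rw [← hπe, wt_nsmul, wt_nsmul]
  have hp : (0 : ℝ) < Dtr.D := by exact_mod_cast Dtr.D_pos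
  exact mul_lt_mul_of_pos_left h1 hp

end GenPlanar

end R9
end Summit.ValiantsHypothesis.ValiantsHypothesis.Theorems.NewtonUnitEquations.TwoProducts.PermutationType

end
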